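import Literature.Combinatorics.SimpleGraph.HarmonicOneForms
import HarnessLib

/-!
# Harmonic morphisms are exactly the morphisms pulling back harmonic functions
# (Baker–Norine 2009, §2.2: Propositions 12 and 13)

Source (held, read at the page; statements VERBATIM). M. Baker, S. Norine, *Harmonic morphisms
and hyperelliptic graphs*, Int. Math. Res. Not. IMRN 2009 [BakerNorine2009] (held text
`paper:arxiv-0707.1309`, chunks p0007–p0008). §2.1: «A function `φ : V(G) ∪ E(G) → V(G′) ∪ E(G′)`
is said to be a morphism from `G` to `G′` if `φ(V(G)) ⊆ V(G′)`, and for every `x ∈ V(G)` and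
`e ∈ E(G)` such that `x ∈ e`, either `φ(e) ∈ E(G′)` and `φ(x) ∈ φ(e)`, or `φ(e) = φ(x)`.» §2.2:
«Recall that given a graph `G` and an abelian group `A`, a function `f : V(G) → A` is said to be
harmonic at `x ∈ V(G)` if `Σ_{e = xy ∈ E(G)} (f(x) − f(y)) = 0`. A morphism `φ : G → G′` is said
to be `A`-harmonic if for any `y = φ(x)` and any function `f : V(G′) → A` harmonic at `y`, the
function `f ∘ φ` is harmonic at `x`. **Proposition 12.** Let `G` and `G′` be graphs, and let
`φ : G → G′` be a harmonic morphism. Then `φ` is `A`-harmonic for every abelian group `A`. […]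
If `G′` is a simple graph (i.e., without multiple edges), then the converse of Proposition 12
also holds: **Proposition 13.** If `G′` is a simple graph, then for a morphism `φ : G → G′`, the
following are equivalent: (1) `φ` is harmonic (i.e., horizontally conformal). (2) `φ` is
`A`-harmonic for every abelian group `A`. (3) `φ` is `ℝ`-harmonic.» Proof of (3) ⇒ (1): «Let
`φ(x) = y`, let `e′ = yz`, and define a function `f_{e′} : V(G′) → ℝ` as follows. Let
`f_{e′}(z) = 1`, let `f_{e′}(y) = 1/deg(y)`, and let `f_{e′}(w) = 0` for `w ∈ V(G′) ∖ {y, z}`. Then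
`f_{e′}` is harmonic at `y`, so by (3), `f_{e′} ∘ φ` is harmonic at `x`. It follows that
`deg(x)/deg(y) = […] = v_φ(x)/deg(y) + k_x(e′)` (since `G′` is simple). Therefore
`k_x(e′) = (deg(x) − v_φ(x))/deg(φ(x))` is independent of the choice of `e′`, as desired.»

## What is formalised (simple graphs; a morphism is a vertex map sending each edge to an edge or
## to a vertex — the `adj_or_eq` clause of `IsHarmonicMorphism`)

* `IsHarmonicAt G f x`, `IsGraphMorphism G G′ φ`, `IsAHarmonic G G′ A φ`;
* **Proposition 12** `IsHarmonicMorphism.isAHarmonic` (every abelian group `A`);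
* **Proposition 13** `isHarmonicMorphism_of_isAHarmonic` ((3) ⇒ (1), for functions with values in
  any field of characteristic `0`, e.g. `ℝ`, following the printed test functions `f_{e′}`) and
  `isHarmonicMorphism_iff_isAHarmonic` ((1) ⇔ (3); (1) ⇒ (2) ⇒ (3) being Proposition 12).

Definitions with bodies and theorems; no `sorry`; no named facts; no instances.
-/

open Finset SimpleGraph
open Literature.Combinatorics.SimpleGraph.ChipFiring

namespace Literature.Combinatorics.SimpleGraph.BakerNorine

/-! ### §1 Harmonic functions at a vertex; morphisms; `A`-harmonic morphisms -/

section Defs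

variable {V V' : Type*}

/-- A **morphism** of simple graphs (its vertex map): every edge `xu` goes to an edge
`φ(x)φ(u)` or to a vertex `φ(x) = φ(u)` («either `φ(e) ∈ E(G′)` and `φ(x) ∈ φ(e)`, or
`φ(e) = φ(x)`»; the `adj_or_eq` clause of `IsHarmonicMorphism`). [cite: BakerNorine2009, §2.1] -/
def IsGraphMorphism (G : SimpleGraph V) (G' : SimpleGraph V') (φ : V → V') : Prop :=
  ∀ ⦃x u : V⦄, G.Adj x u → G'.Adj (φ x) (φ u) ∨ φ x = φ u

/-- «`f : V(G) → A` is said to be harmonic at `x ∈ V(G)` if `Σ_{e = xy ∈ E(G)} (f(x) − f(y)) = 0`.»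
[cite: BakerNorine2009, §2.2] -/
def IsHarmonicAt [Fintype V] (G : SimpleGraph V) [DecidableRel G.Adj] {A : Type*} [AddCommGroup A]
    (f : V → A) (x : V) : Prop :=
  ∑ y ∈ G.neighborFinset x, (f x - f y) = 0

/-- An **`A`-harmonic** vertex map: «for any `y = φ(x)` and any function `f : V(G′) → A` harmonic
at `y`, the function `f ∘ φ` is harmonic at `x`». [cite: BakerNorine2009, §2.2] -/
def IsAHarmonic [Fintype V] [Fintype V'] (G : SimpleGraph V) [DecidableRel G.Adj]
    (G' : SimpleGraph V') [DecidableRel G'.Adj] (A : Type*) [AddCommGroup A] (φ : V → V') : Prop :=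
  ∀ (x : V) (f : V' → A), IsHarmonicAt G' f (φ x) → IsHarmonicAt G (f ∘ φ) x

end Defs

variable {V : Type*} [Fintype V] {G : SimpleGraph V} [DecidableRel G.Adj]
variable {V' : Type*} [Fintype V'] [DecidableEq V'] {G' : SimpleGraph V'} [DecidableRel G'.Adj]

omit [DecidableEq V'] [Fintype V'] [DecidableRel G'.Adj] in
/-- Unfolding `IsHarmonicAt`: `Σ_{y ∼ x} f(y) = deg(x) f(x)`. [cite: BakerNorine2009, §2.2
(«`Σ_{e = zy} f(z) = deg(y) f(y)`», proof of Proposition 12)] -/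
theorem isHarmonicAt_iff {A : Type*} [AddCommGroup A] (f : V → A) (x : V) :
    IsHarmonicAt G f x ↔ ∑ y ∈ G.neighborFinset x, f y = G.degree x • f x := by
  unfold IsHarmonicAt
  rw [sum_sub_distrib, sum_const, card_neighborFinset_eq_degree, sub_eq_zero, eq_comm]

omit [Fintype V'] [DecidableRel G'.Adj] in
/-- A harmonic morphism is a morphism. [cite: BakerNorine2009, §2.1 (Definition)] -/
theorem IsHarmonicMorphism.isGraphMorphism {φ : V → V'} (hφ : IsHarmonicMorphism G G' φ) :
    IsGraphMorphism G G' φ :=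
  hφ.adj_or_eq

/-! ### §2 Proposition 12: harmonic ⇒ `A`-harmonic -/

/-- **Proposition 12**: «Let `φ : G → G′` be a harmonic morphism. Then `φ` is `A`-harmonic for
every abelian group `A`» (`Σ_{u ∼ x} f(φ(u)) = v_φ(x) f(y) + m_φ(x) deg(y) f(y) = deg(x) f(y)` by
the degree identity (2.1)). [cite: BakerNorine2009, Proposition 12] -/
theorem IsHarmonicMorphism.isAHarmonic {φ : V → V'} (hφ : IsHarmonicMorphism G G' φ) (A : Type*)
    [AddCommGroup A] : IsAHarmonic G G' A φ := by
  intro x f hf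
  rw [isHarmonicAt_iff] at hf ⊢
  simp only [Function.comp_apply]
  rw [hφ.sum_neighborFinset_comp_smul f x, hf, hφ.degree_eq x, smul_smul, add_smul, mul_comm,
    add_comm]

/-! ### §3 Proposition 13: `ℝ`-harmonic morphisms of simple graphs are harmonic -/

section Converse

variable {K : Type*} [Field K] [CharZero K]

/-- The printed test function `f_{e′}` for `e′ = yz`: `f(z) = 1`, `f(y) = 1/deg(y)`, `0` elsewhere.
[cite: BakerNorine2009, Proposition 13 (proof)] -/
private noncomputable def testFun (G' : SimpleGraph V') [DecidableRel G'.Adj] (y z : V') : V' → K :=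
  fun w => if w = z then 1 else if w = y then ((G'.degree y : K))⁻¹ else 0

/-- «Then `f_{e′}` is harmonic at `y`.» [cite: BakerNorine2009, Proposition 13 (proof)] -/
private theorem isHarmonicAt_testFun {y z : V'} (hyz : G'.Adj y z) :
    IsHarmonicAt G' (testFun G' (K := K) y z) y := by
  rw [isHarmonicAt_iff]
  have hsum : ∑ w ∈ G'.neighborFinset y, testFun G' (K := K) y z w =
      ∑ w ∈ G'.neighborFinset y, (if w = z then (1 : K) else 0) := by
    refine sum_congr rfl fun w hw => ?_
    have hwy : w ≠ y := fun h => G'.irrefl (h ▸ (mem_neighborFinset _ _ _).1 hw)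
    unfold testFun
    rw [if_neg hwy]
  have hdeg : (G'.degree y : K) ≠ 0 := by
    rw [Nat.cast_ne_zero]
    exact Nat.pos_iff_ne_zero.1 (G'.degree_pos_iff_exists_adj y |>.2 ⟨z, hyz⟩)
  rw [hsum, sum_ite_eq' (G'.neighborFinset y) z, if_pos ((mem_neighborFinset _ _ _).2 hyz)]
  unfold testFun
  rw [if_neg hyz.ne, if_pos rfl, nsmul_eq_mul, mul_inv_cancel₀ hdeg]

/-- The count `k_x(e′)` for `e′ = yz`: «`deg(x)/deg(y) = v_φ(x)/deg(y) + k_x(e′)`», i.e.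
`k_x(e′) = (deg(x) − v_φ(x))/deg(y)` — independent of `z`. [cite: BakerNorine2009, Proposition 13
(proof)] -/
private theorem card_filter_eq_of_isAHarmonic {φ : V → V'} (h : IsAHarmonic G G' K φ) {x : V}
    {z : V'} (hz : G'.Adj (φ x) z) :
    (#{u ∈ G.neighborFinset x | φ u = z} : K) =
      ((G.degree x : K) - (vertMult G φ x : K)) * ((G'.degree (φ x) : K))⁻¹ := by
  have hx := h x _ (isHarmonicAt_testFun (K := K) hz)
  rw [isHarmonicAt_iff] at hx
  simp only [Function.comp_apply] at hx
  -- evaluate `f(φ x) = 1/deg(y)` and split the sum over `φ u = z`, `φ u = y`, others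
  have hfx : testFun G' (K := K) (φ x) z (φ x) = ((G'.degree (φ x) : K))⁻¹ := by
    unfold testFun
    rw [if_neg hz.ne, if_pos rfl]
  have hfilt : (G.neighborFinset x).filter (fun u => ¬φ u = z ∧ φ u = φ x) =
      (G.neighborFinset x).filter (fun u => φ u = φ x) := by
    ext u
    simp only [mem_filter, and_congr_right_iff]
    intro _
    exact ⟨fun h => h.2, fun h => ⟨by rw [h]; exact hz.ne, h⟩⟩
  have hsplit : ∑ u ∈ G.neighborFinset x, testFun G' (K := K) (φ x) z (φ u) =
      (#{u ∈ G.neighborFinset x | φ u = z} : K) +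
        (vertMult G φ x : K) * ((G'.degree (φ x) : K))⁻¹ := by
    unfold testFun
    rw [sum_ite, sum_const, nsmul_eq_mul, mul_one, sum_ite, sum_const_zero, add_zero, sum_const,
      nsmul_eq_mul, filter_filter, hfilt, vertMult_apply]
  rw [hfx, hsplit, nsmul_eq_mul] at hx
  -- hx : k + v/deg = deg(x)/deg
  have hdeg : (G'.degree (φ x) : K) ≠ 0 := by
    rw [Nat.cast_ne_zero]
    exact Nat.pos_iff_ne_zero.1 (G'.degree_pos_iff_exists_adj (φ x) |>.2 ⟨z, hz⟩)
  rw [sub_mul, ← hx]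
  ring

/-- **Proposition 13, (3) ⇒ (1)**: a morphism of simple graphs which is `K`-harmonic for a field
`K` of characteristic `0` (B–N: `K = ℝ`) is harmonic. [cite: BakerNorine2009, Proposition 13] -/
theorem isHarmonicMorphism_of_isAHarmonic {φ : V → V'} (hmor : IsGraphMorphism G G' φ)
    (h : IsAHarmonic G G' K φ) : IsHarmonicMorphism G G' φ where
  adj_or_eq := hmor
  conformal := fun x y₁ y₂ h₁ h₂ => by
    have e₁ := card_filter_eq_of_isAHarmonic (K := K) h h₁
    have e₂ := card_filter_eq_of_isAHarmonic (K := K) h h₂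
    exact Nat.cast_injective (R := K) (e₁.trans e₂.symm)

/-- **Proposition 13**: for a morphism of simple graphs, harmonic ⟺ `K`-harmonic (`K` a field of
characteristic `0`; (1) ⇒ (2) ⇒ (3) is Proposition 12). [cite: BakerNorine2009, Proposition 13] -/
theorem isHarmonicMorphism_iff_isAHarmonic (φ : V → V') :
    IsHarmonicMorphism G G' φ ↔ IsGraphMorphism G G' φ ∧ IsAHarmonic G G' K φ :=
  ⟨fun hφ => ⟨hφ.isGraphMorphism, hφ.isAHarmonic K⟩,
    fun h => isHarmonicMorphism_of_isAHarmonic h.1 h.2⟩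

end Converse

end Literature.Combinatorics.SimpleGraph.BakerNorine
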